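import Summits.Ventures.CertifiedArithmetic.Expansions.WeakExpansionInvariant

/-!
# Weakly nonoverlapping expansions, part 3 (§5–§6): one loop step preserves the invariant

HONEST FRAMING (ENGINES group, unit `eng-quad-4`, kernels lane of the `certquad` engine — shared
numerical engines serving client cells; rigour lives in the verifiers; every published number
belongs to a client cell's ledger, not to the engines group): NEW WORK of the lane's Lean line, not a
published result, hence under `Summits/Ventures/` with no citation tag; nothing here is cited anywhere
as a literature fact.  Overview, statements in words, evidence and the proof outline (§1–§11):
module docstring of `WeakExpansion.lean` in this directory.  This file introduces no definitions.

CONTENTS.  §5 the core dichotomy `FesInvW.core` (what a would-be violation of the grid invariant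
forces); §6 `FesInvW.step`: one TWO-SUM iteration preserves the strengthened invariant with the new
grid `2^(⌊log₂|h|⌋+1)` (any round-to-nearest rounding, `p ≥ 4`).
-/

namespace Summit.Ventures.CertifiedArithmetic.Expansions

open Literature.ComputerArithmetic.JeannerodRump2018
open Literature.ComputerArithmetic.BoldoJeannerodMelquiondMuller2023 hiding twoSum twoSum_fst isFloat_twoSum
open Literature.ComputerArithmetic.Shewchuk1997

variable {p : ℕ} {emin : ℤ} {fl : ℚ → ℚ}

/-! ### §5  The core of the repaired proof: what a would-be violation forces

From a state of the invariant with weakly nonoverlapping inputs, suppose some unprocessed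
component `x₀` is an odd multiple of `2^j` while the processed inputs sum to MORE than
`(2^p − ¼)·2^j`.  Then `x₀` belongs to the OTHER expansion than the component `z` just
processed, the processed part of that expansion sums to `< ¾·2^j` (tail bound below `x₀`), and
`z` is one of the two largest floats below `2^p·2^j` (top bound): either `|z| = (2^p − 1)·2^j` — then
every pair prefix sum is `< 1½·2^j`, so by the history bound at scale `2^(j+1)` every earlier output
is `≤ 2^(j−p)` — or `|z| = (2^p − 2)·2^j`, with the history bound at scale `2^(j+2)`. -/

/-- **CORE DICHOTOMY.**  If after processing `z` the processed inputs sum to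
`> (2^p − ¼)·2^j` while an unprocessed `x₀` is an odd multiple of `2^j`, then `x₀` lies in the other
expansion, `|Σ f₁| < ¾·2^j`, and either (A) `|z| = (2^p − 1)·2^j`, `|Σ e₁| < ¾·2^j`,
`|Σ hs| < 2^(j+1−p)`, or (B) `|z| = (2^p − 2)·2^j`, `|Σ e₁| < 1½·2^j`, `|Σ hs| < 2^(j+2−p)`. -/
theorem FesInvW.core (hp : 2 ≤ p) {e f e₁ f₁ e₂' f₂ : List ℚ} {z Q : ℚ} {hs : List ℚ} {g : ℤ}
    (heF : ∀ x ∈ e, IsFloat p emin x) (hes : IsWeakExpansion e)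
    (hfF : ∀ x ∈ f, IsFloat p emin x) (hfs : IsWeakExpansion f)
    (hI : FesInvW p emin e f e₁ f₁ (z :: e₂') f₂ Q hs g) (hzle : ∀ x ∈ f₂, x ≠ 0 → |z| ≤ |x|)
    (hz0 : z ≠ 0) {x₀ : ℚ} (hx₀ : x₀ ∈ e₂' ++ f₂) {M₀ j : ℤ} (hM₀ : Odd M₀) (hM₀p : |M₀| < 2 ^ p)
    (hx₀e : x₀ = (M₀ : ℚ) * (2 : ℚ) ^ j)
    (hS : (2 ^ p - 1 / 4) * (2 : ℚ) ^ j < |(e₁ ++ [z]).sum + f₁.sum|) :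
    x₀ ∈ f₂ ∧ |f₁.sum| < 3 / 4 * (2 : ℚ) ^ j ∧
      ((|z| = (2 ^ p - 1) * (2 : ℚ) ^ j ∧ |e₁.sum| < 3 / 4 * (2 : ℚ) ^ j ∧
          |hs.sum| < (2 : ℚ) ^ (j + 1 - p)) ∨
        (|z| = (2 ^ p - 2) * (2 : ℚ) ^ j ∧ |e₁.sum| < 3 / 2 * (2 : ℚ) ^ j ∧
          |hs.sum| < (2 : ℚ) ^ (j + 2 - p))) := by
  have h2 : (0 : ℚ) < 2 := by norm_num
  have h2j : (0 : ℚ) < (2 : ℚ) ^ j := zpow_pos h2 _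
  have h4p : (4 : ℚ) ≤ 2 ^ p :=
    calc (4 : ℚ) = 2 ^ 2 := by norm_num
      _ ≤ 2 ^ p := pow_le_pow_right₀ (by norm_num) hp
  have hp0 : p ≠ 0 := by omega
  have hM₀0 : M₀ ≠ 0 := by rintro rfl; exact (by decide : ¬ Odd (0 : ℤ)) hM₀
  have hx₀0 : x₀ ≠ 0 := by rw [hx₀e]; exact mul_ne_zero (by exact_mod_cast hM₀0) h2j.ne'
  have he' : e = (e₁ ++ [z]) ++ e₂' := by rw [hI.inv.he]; simp
  have hze : z ∈ e := by rw [hI.inv.he]; exact List.mem_append_right _ List.mem_cons_self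
  have hzF : IsFloat p emin z := heF z hze
  have hsube : (e₁ ++ [z]).Sublist e := by rw [he']; exact List.sublist_append_left _ _
  have hsubf : f₁.Sublist f := by rw [hI.inv.hf]; exact List.sublist_append_left _ _
  have he₁F : ∀ y ∈ e₁, IsFloat p emin y := fun y hy => heF y (hsube.subset (List.mem_append_left _ hy))
  have hf₁F : ∀ y ∈ f₁, IsFloat p emin y := fun y hy => hfF y (hsubf.subset hy)
  have hwez : IsWeakExpansion (e₁ ++ [z]) := hes.sublist hsube
  have hf₁exp : IsExpansion 1 f₁ := (hfs.sublist hsubf).isExpansion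
  -- tail bounds for prefixes (§2)
  have tailE : ∀ {x : ℚ}, x ∈ e₂' → ∀ {M v : ℤ}, Odd M → x = M * (2 : ℚ) ^ v →
      ∀ e', e' <+: e₁ ++ [z] → |e'.sum| < 3 / 4 * (2 : ℚ) ^ v := by
    intro x hx M v hM hxe e' hpre
    have hsubl : (e' ++ [x]).Sublist e := by
      rw [he']; exact hpre.sublist.append (List.singleton_sublist.mpr hx)
    exact abs_sum_lt_of_isWeakExpansion_append' (fun y hy => heF y (hsubl.subset
      (List.mem_append_left _ hy))) (hes.sublist hsubl) hM hxe
  have tailF : ∀ {x : ℚ}, x ∈ f₂ → ∀ {M v : ℤ}, Odd M → x = M * (2 : ℚ) ^ v →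
      ∀ f', f' <+: f₁ → |f'.sum| < 3 / 4 * (2 : ℚ) ^ v := by
    intro x hx M v hM hxe f' hpre
    have hsubl : (f' ++ [x]).Sublist f := by
      rw [hI.inv.hf]; exact hpre.sublist.append (List.singleton_sublist.mpr hx)
    exact abs_sum_lt_of_isWeakExpansion_append' (fun y hy => hfF y (hsubl.subset
      (List.mem_append_left _ hy))) (hfs.sublist hsubl) hM hxe
  have tailZ : ∀ {M v : ℤ}, Odd M → z = M * (2 : ℚ) ^ v →
      ∀ e', e' <+: e₁ → |e'.sum| < 3 / 4 * (2 : ℚ) ^ v := by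
    intro M v hM hze' e' hpre
    have hsubl : (e' ++ [z]).Sublist e :=
      (hpre.sublist.append (List.Sublist.refl [z])).trans hsube
    exact abs_sum_lt_of_isWeakExpansion_append' (fun y hy => heF y (hsubl.subset
      (List.mem_append_left _ hy))) (hes.sublist hsubl) hM hze'
  rcases List.mem_append.mp hx₀ with hx₀e' | hx₀f
  · -- `x₀` in the SAME expansion as `z`: then everything processed is tiny — impossible
    exfalso
    have hzx : WeakBelow z x₀ := by
      have hpw := hes.1
      rw [hI.inv.he, List.pairwise_append, List.pairwise_cons] at hpw
      exact hpw.2.1.1 x₀ hx₀e'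
    have hsv : ∀ s, OnGrid s x₀ → (2 : ℚ) ^ s ≤ (2 : ℚ) ^ j := fun s hs =>
      zpow_le_zpow_right₀ (by norm_num) (OnGrid.le_of_odd hM₀ (by rwa [hx₀e] at hs))
    have hzj : |z| < (2 : ℚ) ^ j := by
      rcases hzx.below_one with ⟨s, hs, hlt⟩
      rw [one_mul] at hlt
      exact lt_of_lt_of_le hlt (hsv s hs)
    have hE : |(e₁ ++ [z]).sum| < 3 / 4 * (2 : ℚ) ^ j := tailE hx₀e' hM₀ hx₀e _ (List.prefix_refl _)
    have hF : |f₁.sum| < (2 : ℚ) ^ j := by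
      refine abs_sum_lt_two_zpow_of_isExpansion hf₁F hf₁exp (fun y hy => ?_)
      have := hI.inv.hle y (List.mem_append_right _ hy) z
        (List.mem_append_left _ List.mem_cons_self) hz0
      linarith
    have : |(e₁ ++ [z]).sum + f₁.sum| < (2 ^ p - 1 / 4) * (2 : ℚ) ^ j :=
      calc |(e₁ ++ [z]).sum + f₁.sum| ≤ |(e₁ ++ [z]).sum| + |f₁.sum| := abs_add_le _ _
        _ < 3 / 4 * (2 : ℚ) ^ j + (2 : ℚ) ^ j := by linarith
        _ ≤ (2 ^ p - 1 / 4) * (2 : ℚ) ^ j := by nlinarith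
    linarith
  · -- `x₀` in the OTHER expansion
    have hFt : |f₁.sum| < 3 / 4 * (2 : ℚ) ^ j := tailF hx₀f hM₀ hx₀e _ (List.prefix_refl _)
    have hEz : (2 ^ p - 1) * (2 : ℚ) ^ j < |(e₁ ++ [z]).sum| := by
      have htri := abs_add_le (e₁ ++ [z]).sum f₁.sum
      have : (2 ^ p - 1 / 4) * (2 : ℚ) ^ j - 3 / 4 * (2 : ℚ) ^ j = (2 ^ p - 1) * (2 : ℚ) ^ j := by
        ring
      linarith
    have hx₀abs : |x₀| ≤ (2 ^ p - 1) * (2 : ℚ) ^ j := by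
      rw [hx₀e, abs_mul, abs_of_pos h2j]
      have h1 : |M₀| ≤ (2 : ℤ) ^ p - 1 := by
        have := Int.lt_iff_add_one_le.mp hM₀p; linarith
      have h1' : ((|M₀| : ℤ) : ℚ) ≤ (((2 : ℤ) ^ p - 1 : ℤ) : ℚ) := by exact_mod_cast h1
      push_cast at h1'
      exact mul_le_mul_of_nonneg_right h1' h2j.le
    have hzle' : |z| ≤ (2 ^ p - 1) * (2 : ℚ) ^ j := le_trans (hzle x₀ hx₀f hx₀0) hx₀abs
    have htop := abs_top_of_isWeakExpansion hp he₁F hzF hz0 hwez hzle' hEz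
    have hj1 : (2 : ℚ) ^ (j + 1) = 2 * (2 : ℚ) ^ j := by
      rw [zpow_add_one₀ h2.ne']; ring
    have hj2 : (2 : ℚ) ^ (j + 2) = 4 * (2 : ℚ) ^ j := by
      rw [zpow_add₀ h2.ne']; norm_num; ring
    have hjp1 : (2 : ℚ) ^ (j + 1 - p) ≤ (2 : ℚ) ^ j / 2 := by
      have := zpow_le_zpow_right₀ (by norm_num : (1:ℚ) ≤ 2) (by omega : j + 1 - p ≤ j - 1)
      rw [zpow_sub_one₀ h2.ne'] at this; linarith
    have hjp2 : (2 : ℚ) ^ (j + 2 - p) ≤ (2 : ℚ) ^ j := by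
      exact zpow_le_zpow_right₀ (by norm_num : (1:ℚ) ≤ 2) (by omega : j + 2 - p ≤ j)
    have hsumHs : ∀ {b : ℤ}, (∀ x ∈ hs, |x| ≤ (2 : ℚ) ^ (b - 1)) → |hs.sum| < (2 : ℚ) ^ b :=
      fun hb => abs_sum_lt_two_zpow_of_isExpansion hI.inv.hhs hI.inv.hexp fun x hx =>
        lt_of_le_of_lt (hb x hx) (zpow_lt_zpow_right₀ (by norm_num) (by omega))
    refine ⟨hx₀f, hFt, htop.imp (fun hA => ?_) (fun hB => ?_)⟩
    · -- case A: `z = ±(2^p − 1)·2^j`, an odd multiple of `2^j`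
      obtain ⟨Mz, hMz, hze'⟩ : ∃ Mz : ℤ, Odd Mz ∧ z = Mz * (2 : ℚ) ^ j := by
        have hodd : Odd ((2 : ℤ) ^ p - 1) :=
          ((Int.even_pow' hp0).mpr even_two).sub_odd odd_one
        rcases (abs_eq (mul_nonneg (by linarith) h2j.le : (0 : ℚ) ≤ (2 ^ p - 1) * (2 : ℚ) ^ j)).mp hA
          with h | h
        · exact ⟨2 ^ p - 1, hodd, by rw [h]; push_cast; ring⟩
        · exact ⟨-(2 ^ p - 1), hodd.neg, by rw [h]; push_cast; ring⟩
      have hEt : ∀ e', e' <+: e₁ → |e'.sum| < 3 / 4 * (2 : ℚ) ^ j := tailZ hMz hze'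
      have hpair : ∀ e' f' : List ℚ, e' <+: e₁ → f' <+: f₁ →
          |e'.sum + f'.sum| < (2 : ℚ) ^ (j + 1) - (2 : ℚ) ^ (j + 1 - p) := by
        intro e' f' he' hf'
        have h1 := hEt e' he'
        have h2' := tailF hx₀f hM₀ hx₀e f' hf'
        calc |e'.sum + f'.sum| ≤ |e'.sum| + |f'.sum| := abs_add_le _ _
          _ < 3 / 4 * (2 : ℚ) ^ j + 3 / 4 * (2 : ℚ) ^ j := by linarith
          _ ≤ (2 : ℚ) ^ (j + 1) - (2 : ℚ) ^ (j + 1 - p) := by rw [hj1]; linarith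
      have hout : ∀ x ∈ hs, |x| ≤ (2 : ℚ) ^ (j + 1 - 1 - p) := hI.hist (j + 1) hpair
      refine ⟨hA, hEt e₁ (List.prefix_refl _), hsumHs fun x hx => ?_⟩
      rw [show j + 1 - (p : ℤ) - 1 = j + 1 - 1 - p by ring]; exact hout x hx
    · -- case B: `z = ±(2^(p−1) − 1)·2^(j+1)`, an odd multiple of `2^(j+1)`
      obtain ⟨Mz, hMz, hze'⟩ : ∃ Mz : ℤ, Odd Mz ∧ z = Mz * (2 : ℚ) ^ (j + 1) := by
        have hodd : Odd ((2 : ℤ) ^ (p - 1) - 1) :=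
          ((Int.even_pow' (by omega)).mpr even_two).sub_odd odd_one
        have hpp : (2 : ℚ) ^ p = 2 * 2 ^ (p - 1) := by
          rw [← pow_succ']; congr 1; omega
        rcases (abs_eq (mul_nonneg (by linarith) h2j.le : (0 : ℚ) ≤ (2 ^ p - 2) * (2 : ℚ) ^ j)).mp hB
          with h | h
        · exact ⟨2 ^ (p - 1) - 1, hodd, by rw [h, hj1, hpp]; push_cast; ring⟩
        · exact ⟨-(2 ^ (p - 1) - 1), hodd.neg, by rw [h, hj1, hpp]; push_cast; ring⟩
      have hEt : ∀ e', e' <+: e₁ → |e'.sum| < 3 / 2 * (2 : ℚ) ^ j := by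
        intro e' he'
        have := tailZ hMz hze' e' he'
        rw [hj1] at this; linarith
      have hpair : ∀ e' f' : List ℚ, e' <+: e₁ → f' <+: f₁ →
          |e'.sum + f'.sum| < (2 : ℚ) ^ (j + 2) - (2 : ℚ) ^ (j + 2 - p) := by
        intro e' f' he' hf'
        have h1 := hEt e' he'
        have h2' := tailF hx₀f hM₀ hx₀e f' hf'
        calc |e'.sum + f'.sum| ≤ |e'.sum| + |f'.sum| := abs_add_le _ _
          _ < 3 / 2 * (2 : ℚ) ^ j + 3 / 4 * (2 : ℚ) ^ j := by linarith
          _ ≤ (2 : ℚ) ^ (j + 2) - (2 : ℚ) ^ (j + 2 - p) := by rw [hj2]; linarith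
      have hout : ∀ x ∈ hs, |x| ≤ (2 : ℚ) ^ (j + 2 - 1 - p) := hI.hist (j + 2) hpair
      refine ⟨hB, hEt e₁ (List.prefix_refl _), hsumHs fun x hx => ?_⟩
      rw [show j + 2 - (p : ℤ) - 1 = j + 2 - 1 - p by ring]; exact hout x hx

/-! ### §6  One loop iteration preserves the strengthened invariant

The bookkeeping (sum, ordering, floats, the zero-output case, the grid containing `Q'`) is that of
`FesInv.step`; the history bound propagates by the plain error bound of rounding to nearest; and the
new grid fact — every unprocessed component is a multiple of `2^(T+1)` — is where §5 replaces
Lemma 15: a violating `x₀ = M₀·2^i` (`M₀` odd, `i ≤ T`) has `i = T` (coarse size bound), and then §5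
bounds `|Q + z|` by `(2^p + ½ + 2^(1−p))·2^T` resp. `(2^p + ¼ + 2^(2−p))·2^T < (2^p + 1)·2^T`,
contradicting Corollary 8(a).  (The second case is where `p ≥ 4` enters.) -/

/-- **STEP.**  One TWO-SUM iteration of the loop preserves the strengthened invariant, with the
new grid `2^(T+1)`, `T = ⌊log₂|h|⌋`, when the output `h` is nonzero (any round-to-nearest, `p ≥ 4`;
oriented: `z`, the next merged component, comes from `e`). -/
theorem FesInvW.step (hp : 4 ≤ p) (hfl : IsRoundNearest p emin fl)
    {e f e₁ f₁ e₂' f₂ : List ℚ} {z Q : ℚ} {hs : List ℚ} {g : ℤ}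
    (heF : ∀ x ∈ e, IsFloat p emin x) (hes : IsWeakExpansion e)
    (hfF : ∀ x ∈ f, IsFloat p emin x) (hfs : IsWeakExpansion f)
    (hI : FesInvW p emin e f e₁ f₁ (z :: e₂') f₂ Q hs g) (hzle : ∀ x ∈ f₂, x ≠ 0 → |z| ≤ |x|) :
    ∃ g' : ℤ, FesInvW p emin e f (e₁ ++ [z]) f₁ e₂' f₂ (twoSum fl Q z).1
      (hs ++ [(twoSum fl Q z).2]) g' ∧ |(twoSum fl Q z).2| < (2 : ℚ) ^ g' ∧
      ((twoSum fl Q z).2 ≠ 0 → g' = Int.log 2 |(twoSum fl Q z).2| + 1) := by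
  have hp1 : 1 ≤ p := le_trans (by norm_num) hp
  have hp2 : 2 ≤ p := le_trans (by norm_num) hp
  have h2 : (0 : ℚ) < 2 := by norm_num
  have hze : z ∈ e := by rw [hI.inv.he]; exact List.mem_append_right _ List.mem_cons_self
  have hzF : IsFloat p emin z := heF z hze
  set Q' : ℚ := (twoSum fl Q z).1 with hQ'def
  set h : ℚ := (twoSum fl Q z).2 with hhdef
  have hQ'F : IsFloat p emin Q' := (isFloat_twoSum hfl Q z).1
  have hhF : IsFloat p emin h := (isFloat_twoSum hfl Q z).2
  obtain ⟨hh_eq, hQh⟩ := twoSum_exact hp1 hfl hI.inv.hQ hzF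
  rw [← hhdef] at hh_eq hQh
  rw [← hQ'def] at hQh
  have hQ'eq : Q' = fl (Q + z) := Literature.ComputerArithmetic.Shewchuk1997.twoSum_fst fl Q z
  -- bookkeeping valid in both cases (as in `FesInv.step`)
  have he' : e = (e₁ ++ [z]) ++ e₂' := by rw [hI.inv.he]; simp
  have hsube : (e₁ ++ [z]).Sublist e := by rw [he']; exact List.sublist_append_left _ _
  have hsubf : f₁.Sublist f := by rw [hI.inv.hf]; exact List.sublist_append_left _ _
  have hf₁F : ∀ y ∈ f₁, IsFloat p emin y := fun y hy => hfF y (hsubf.subset hy)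
  have hf₁exp : IsExpansion 1 f₁ := (hfs.sublist hsubf).isExpansion
  have hsum' : Q' + (hs ++ [h]).sum = (e₁ ++ [z]).sum + f₁.sum := by
    rw [List.sum_append, List.sum_singleton, List.sum_append, List.sum_singleton]
    have := hI.inv.hsum
    linear_combination hQh + this
  have hWBz : ∀ x ∈ e₂', WeakBelow z x := by
    have hpw := hes.1
    rw [hI.inv.he, List.pairwise_append, List.pairwise_cons] at hpw
    exact hpw.2.1.1
  have hsub : ∀ x ∈ e₂' ++ f₂, x ∈ (z :: e₂') ++ f₂ := fun x hx =>
    (List.mem_append.mp hx).elim (fun hx => List.mem_append_left _ (List.mem_cons_of_mem _ hx))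
      fun hx => List.mem_append_right _ hx
  have hle' : ∀ y ∈ (e₁ ++ [z]) ++ f₁, ∀ x ∈ e₂' ++ f₂, x ≠ 0 → |y| ≤ |x| := by
    intro y hy x hx hx0
    rcases List.mem_append.mp hy with hy | hy
    · rcases List.mem_append.mp hy with hy | hy
      · exact hI.inv.hle y (List.mem_append_left _ hy) x (hsub x hx) hx0
      · rw [List.mem_singleton.mp hy]
        rcases List.mem_append.mp hx with hx | hx
        · exact ((hWBz x hx).abs_lt hx0).le
        · exact hzle x hx hx0
    · exact hI.inv.hle y (List.mem_append_right _ hy) x (hsub x hx) hx0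
  have hhs' : ∀ x ∈ hs ++ [h], IsFloat p emin x := by
    intro x hx
    rcases List.mem_append.mp hx with hx | hx
    · exact hI.inv.hhs x hx
    · rw [List.mem_singleton.mp hx]; exact hhF
  have hQzg : OnGrid g (Q + z) :=
    hI.inv.hQg.add (hI.inv.hrg z (List.mem_append_left _ List.mem_cons_self))
  have hQ'g : OnGrid g Q' := by rw [hQ'eq]; exact hQzg.fl_of hp1 hfl hI.inv.hg
  have hhg : OnGrid g h := by rw [hh_eq]; exact hQzg.sub (hQ'eq ▸ hQ'g)
  have hQz : Q + z = ((e₁ ++ [z]).sum + f₁.sum) - hs.sum := by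
    have := hI.inv.hsum
    rw [List.sum_append, List.sum_singleton]; linear_combination this
  -- the HISTORY BOUND propagates: the error bound of rounding to nearest at scale `2^a`
  have hist' : ∀ a : ℤ, (∀ e' f' : List ℚ, e' <+: e₁ ++ [z] → f' <+: f₁ →
      |e'.sum + f'.sum| < (2 : ℚ) ^ a - (2 : ℚ) ^ (a - p)) →
      ∀ x ∈ hs ++ [h], |x| ≤ (2 : ℚ) ^ (a - 1 - p) := by
    intro a ha x hx
    have hold : ∀ x ∈ hs, |x| ≤ (2 : ℚ) ^ (a - 1 - p) :=
      hI.hist a fun e' f' he'' hf' => ha e' f' (he''.trans (List.prefix_append e₁ [z])) hf'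
    rcases List.mem_append.mp hx with hx | hx
    · exact hold x hx
    rw [List.mem_singleton.mp hx]
    have hHs : |hs.sum| < (2 : ℚ) ^ (a - p) :=
      abs_sum_lt_two_zpow_of_isExpansion hI.inv.hhs hI.inv.hexp fun y hy =>
        lt_of_le_of_lt (hold y hy) (zpow_lt_zpow_right₀ (by norm_num) (by omega))
    have hSa : |(e₁ ++ [z]).sum + f₁.sum| < (2 : ℚ) ^ a - (2 : ℚ) ^ (a - p) :=
      ha _ _ (List.prefix_refl _) (List.prefix_refl _)
    have hX : |Q + z| < (2 : ℚ) ^ a := by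
      rw [hQz]
      have := abs_sub ((e₁ ++ [z]).sum + f₁.sum) hs.sum
      linarith
    rw [hh_eq]
    rcases le_or_gt emin (a - p) with hem | hem
    · have hpow : (2 : ℚ) ^ a = (2 : ℚ) ^ (a - 1 - p) * 2 ^ (p + 1) := by
        rw [← zpow_natCast, ← zpow_add₀ h2.ne']; congr 1; push_cast; ring
      have hXle : |Q + z| ≤ (2 : ℚ) ^ (a - 1 - p) * (2 ^ (p + 1) + 1) := by
        rw [mul_add, mul_one, ← hpow]
        linarith [zpow_nonneg h2.le (a - 1 - p)]
      exact abs_err_le_two_zpow hp1 hfl (i := a - 1 - p) (by omega) hXle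
    · -- below the underflow threshold `Q + z` is itself a float: no roundoff at all
      have hgrid : OnGrid emin (Q + z) := (OnGrid.of_isFloat hI.inv.hQ).add (OnGrid.of_isFloat hzF)
      have hlt : |Q + z| < (2 : ℚ) ^ (emin + p) :=
        lt_of_lt_of_le hX (zpow_le_zpow_right₀ (by norm_num) (by omega))
      rw [fl_eq_self hfl (isFloat_of_onGrid_of_abs_lt hgrid hlt), sub_self, abs_zero]
      exact zpow_nonneg h2.le _
  by_cases hh0 : h = 0
  · -- a zero output: nothing moves
    refine ⟨g, ⟨⟨he', hI.inv.hf, hQ'F, hsum', hle', hhs', ?_, hI.inv.hg, hQ'g,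
      fun x hx => hI.inv.hrg x (hsub x hx), ?_⟩, hist'⟩, by rw [hh0, abs_zero]; exact zpow_pos h2 g,
      fun hne => absurd hh0 hne⟩
    · rw [IsExpansion, List.pairwise_append]
      exact ⟨hI.inv.hexp, List.pairwise_singleton _ _, fun a _ b hb => by
        rw [List.mem_singleton.mp hb, hh0]; exact below_zero_right 1 a⟩
    · intro x hx
      rcases List.mem_append.mp hx with hx | hx
      · exact hI.inv.hhg x hx
      · rw [List.mem_singleton.mp hx, hh0, abs_zero]; exact zpow_pos h2 g
  · -- a nonzero output `h`, `2^T ≤ |h| < 2^(T+1)`: the new grid is `2^(T+1)`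
    set T : ℤ := Int.log 2 |h| with hTdef
    obtain ⟨hz0, -, -, -, -, -, hTh, hhT, hgT, -, -, hC, hbig⟩ :=
      FesInvW.prelude hp1 hfl heF hI.inv hQ'def.symm hhdef.symm hh0 hTdef.symm
    have hgT' : (2 : ℚ) ^ g ≤ (2 : ℚ) ^ T := zpow_le_zpow_right₀ (by norm_num) hgT
    have hQ'G : OnGrid (T + 1) Q' := by
      obtain ⟨s, hs, hlt⟩ := below_one_sub_fl hp1 hfl (Q + z)
      rw [one_mul, ← hh_eq] at hlt
      have hTs : T + 1 ≤ s := by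
        have := (zpow_lt_zpow_iff_right₀ (by norm_num : (1:ℚ) < 2)).mp (lt_of_le_of_lt hTh hlt)
        omega
      rw [hQ'eq]; exact hs.mono hTs
    -- every remaining input is a multiple of `2^(T+1)` (§5 + Corollary 8(a))
    have hrg' : ∀ x ∈ e₂' ++ f₂, OnGrid (T + 1) x := by
      intro x₀ hx₀
      by_contra hnot
      have hx₀0 : x₀ ≠ 0 := fun h0 => hnot (h0 ▸ OnGrid.zero _)
      have hx₀F : IsFloat p emin x₀ := by
        rcases List.mem_append.mp hx₀ with hx | hx
        · exact heF x₀ (by rw [he']; exact List.mem_append_right _ hx)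
        · exact hfF x₀ (by rw [hI.inv.hf]; exact List.mem_append_right _ hx)
      obtain ⟨M₀, i, hM₀, hM₀p, -, hx₀e⟩ := exists_odd_mul_two_zpow hx₀F hx₀0
      have hiT : i ≤ T := by
        by_contra hlt
        push Not at hlt
        exact hnot (OnGrid.mono ⟨M₀, hx₀e⟩ (by omega))
      have hTi : T ≤ i := by
        by_contra hlt
        push Not at hlt
        -- coarse bound: processed components are floats `≤ |x₀| < 2^(i+p)`
        have hM₀' : |(M₀ : ℚ)| < 2 ^ p := by exact_mod_cast hM₀p
        have hx₀lt : |x₀| < (2 : ℚ) ^ (i + p) :=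
          calc |x₀| = |(M₀ : ℚ)| * (2 : ℚ) ^ i := by rw [hx₀e, abs_mul, abs_of_pos (zpow_pos h2 _)]
            _ < 2 ^ p * (2 : ℚ) ^ i := mul_lt_mul_of_pos_right hM₀' (zpow_pos h2 _)
            _ = (2 : ℚ) ^ (i + p) := by rw [zpow_add₀ h2.ne', zpow_natCast, mul_comm]
        have hE : |(e₁ ++ [z]).sum| < (2 : ℚ) ^ (i + p) :=
          abs_sum_lt_two_zpow_of_isExpansion (fun y hy => heF y (hsube.subset hy))
            (hes.sublist hsube).isExpansion
            fun y hy => lt_of_le_of_lt (hle' y (List.mem_append_left _ hy) x₀ hx₀ hx₀0) hx₀lt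
        have hF : |f₁.sum| < (2 : ℚ) ^ (i + p) :=
          abs_sum_lt_two_zpow_of_isExpansion hf₁F hf₁exp
            fun y hy => lt_of_le_of_lt (hle' y (List.mem_append_right _ hy) x₀ hx₀ hx₀0) hx₀lt
        have h2ip : (2 : ℚ) ^ (i + p) + (2 : ℚ) ^ (i + p) ≤ (2 : ℚ) ^ (T + p) := by
          have := zpow_le_zpow_right₀ (by norm_num : (1:ℚ) ≤ 2) (by omega : i + p + 1 ≤ T + p)
          rw [zpow_add_one₀ h2.ne'] at this; linarith
        have := abs_add_le (e₁ ++ [z]).sum f₁.sum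
        linarith
      obtain rfl : i = T := le_antisymm hiT hTi  -- eliminates `i`
      have h2T : (0 : ℚ) < (2 : ℚ) ^ T := zpow_pos h2 _
      have hS' : (2 ^ p - 1 / 4) * (2 : ℚ) ^ T < |(e₁ ++ [z]).sum + f₁.sum| := by
        have : (2 ^ p - 1 / 4) * (2 : ℚ) ^ T ≤ (2 : ℚ) ^ (T + p) := by
          rw [zpow_add₀ h2.ne', zpow_natCast]; nlinarith
        linarith
      obtain ⟨-, hFt, hAB⟩ := hI.core hp2 heF hes hfF hfs hzle hz0 hx₀ hM₀ hM₀p hx₀e hS'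
      have hXeq : Q + z = e₁.sum + z + f₁.sum - hs.sum := by
        rw [hQz, List.sum_append, List.sum_singleton]
      have t1 := abs_sub (e₁.sum + z + f₁.sum) hs.sum
      have t2 := abs_add_le (e₁.sum + z) f₁.sum
      have t3 := abs_add_le e₁.sum z
      have hTp : (2 : ℚ) ^ (T + 1 - p) ≤ (2 : ℚ) ^ T / 2 := by
        have := zpow_le_zpow_right₀ (by norm_num : (1:ℚ) ≤ 2) (by omega : T + 1 - p ≤ T - 1)
        rw [zpow_sub_one₀ h2.ne'] at this; linarith
      have hTp' : (2 : ℚ) ^ (T + 2 - p) ≤ (2 : ℚ) ^ T / 4 := by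
        have := zpow_le_zpow_right₀ (by norm_num : (1:ℚ) ≤ 2) (by omega : T + 2 - p ≤ T - 2)
        rw [show T - 2 = T - 1 - 1 by ring, zpow_sub_one₀ h2.ne', zpow_sub_one₀ h2.ne'] at this
        linarith
      rw [hXeq] at hC
      rcases hAB with ⟨hzA, hE1, hHs⟩ | ⟨hzB, hE1, hHs⟩
      · have : |e₁.sum + z + f₁.sum - hs.sum| < (2 : ℚ) ^ T * (2 ^ p + 1) := by
          have hz' : |z| ≤ (2 ^ p - 1) * (2 : ℚ) ^ T := hzA.le
          nlinarith
        linarith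
      · have : |e₁.sum + z + f₁.sum - hs.sum| < (2 : ℚ) ^ T * (2 ^ p + 1) := by
          have hz' : |z| ≤ (2 ^ p - 2) * (2 : ℚ) ^ T := hzB.le
          nlinarith
        linarith
    refine ⟨T + 1, ⟨⟨he', hI.inv.hf, hQ'F, hsum', hle', hhs', ?_, by have := hI.inv.hg; omega,
      hQ'G, hrg', ?_⟩, hist'⟩, hhT, fun _ => rfl⟩
    · -- the EARLIER outputs lie 1-below `h` via the grid `2^g ∋ h`
      rw [IsExpansion, List.pairwise_append]
      exact ⟨hI.inv.hexp, List.pairwise_singleton _ _, fun a ha b hb => by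
        rw [List.mem_singleton.mp hb]; exact ⟨g, hhg, by rw [one_mul]; exact hI.inv.hhg a ha⟩⟩
    · intro x hx
      rcases List.mem_append.mp hx with hx | hx
      · exact lt_of_lt_of_le (hI.inv.hhg x hx)
          (le_trans hgT' (zpow_le_zpow_right₀ (by norm_num) (by omega)))
      · rw [List.mem_singleton.mp hx]; exact hhT

end Summit.Ventures.CertifiedArithmetic.Expansions
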